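import Summits.QuantumFields.YangMills.Theorems.BalabanLadderROTWardSBP
import Summits.QuantumFields.YangMills.Theorems.LangevinControlUVOSLegsAtWeakCouplingCStubDensity
import Mathlib.Analysis.Calculus.MeanValue
import HarnessLib

/-!
# Crux `ROT` (stmt-QuantumFields-20042), infinitesimal Ward route (lane B) — II: the Taylor remainder, the Riemann count, the collar bound

Helper file (`--supports stmt-QuantumFields-20042`, lane `ym-rot-20042-p2`; vocabulary `Theorems/BalabanLadderROTWardDefs.lean`).
The three estimates that turn the exact summation-by-parts identity of `…WardSBP.lean` into a limit statement along schemes: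

* §1 **continuum vs lattice generator** — for a compactly supported test function `F` the derivative `dF` is Lipschitz
  (`exists_lipschitz_fderiv`), hence the second-order Taylor remainder `‖F(y+v) − F(y) − dF(y)·v‖ ≤ K‖v‖²` (`norm_taylor_two_le`,
  mean-value inequality along the segment); the rotation generator field is the combination `Σᵢ (yᵢ⁰ ê_{i,1} − yᵢ¹ ê_{i,0})` of slot
  unit vectors (`rotField_eq_sum`), so `E_a F(x) − (D F)(a x) = Σᵢ (xᵢ⁰ ρ(a x, a ê_{i,1}) − xᵢ¹ ρ(a x, a ê_{i,0}))`
  (`latGen_sub_rotDeriv`), of norm `≤ 2 n K a² ‖x‖∞` (`norm_latGen_sub_rotDeriv_le`) and supported within `a` of `tsupport F`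
  (`exists_mem_tsupport_of_latGen_sub_rotDeriv_ne_zero`);
* §2 **Riemann count** (`eventually_card_scaled_le`): along lattices with `a_k → 0⁺`, `a_k L_k → ∞`,
  `a_k^{4n} · #{x ∈ (box L_k)ⁿ : ‖a_k x‖ ≤ ρ+1}` is eventually bounded (tree `tendsto_riemann_sum` on a bump);
* §3 **collar bound at scaled-separated multi-sites** (`abs_torusMoment_le_of_scaled_separated`): the estimate inside the landed
  `Theorems.ROT.offDiagDensity_of_tendsto_latticeDist`, isolated — in the regime `0 < a ≤ min 1 ℓ₄`, `12a ≤ δ`, `L ≥ 14`, `L ≥ a⁻²`,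
  at bulk multi-sites whose scaled points are pairwise `≥ δ` apart the unpacked `MomentBounds` estimate gives `|W(x)| ≤ (Cκ⁴)ⁿ a⁴ⁿ`,
  `κ = 24/δ + 2/ℓ₄ + 24` (tree `exists_collar_radius`, `exists_valMinAbs_ge_of_norm_le`).

Refs: Glimm–Jaffe 1987 §6.1 (lattice approximation, Riemann sums); tree toolkit VI-c (`…StubAssemblyUniformBoundMain.lean`),
`…AtWeakCouplingCStubDensity.lean` (`tendsto_riemann_sum`), `…SketchGermWardOrbit.lean` (style of the orbit calculus).  No
definition, no fact, no sorry.
-/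

set_option autoImplicit false

noncomputable section

open scoped SchwartzMap BigOperators
open MeasureTheory Filter Topology Metric
open Literature.MathematicalPhysics.QuantumFieldTheory Literature.MathematicalPhysics.QuantumLattice
open Literature.MathematicalPhysics.AQFT
open Literature.Probability.LatticeModels (box Site mem_box)
open Summit.QuantumFields.YangMills.Cruxes.OSLegsFromFemtoAndGap.DlrCollarTransfer (MomentBounds MomentBounds6 LowerBounds)
open Summit.QuantumFields.YangMills.Cruxes.OSLegsAtWeakCouplingC.Sketch (Separated SmallDiam)
open Summit.QuantumFields.YangMills.Cruxes.OSLegsAtWeakCouplingC.Y2Bridge (LatticeRotWard)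
open Summit.QuantumFields.YangMills.Theorems.OSLegsFromFemtoAndGap (latticeDist torusMoment latticeDist_apply
  mul_norm_le_norm_smul_siteToE norm_smul_siteToE_sub_le integrable_prod_obs exists_collar_radius exists_valMinAbs_ge_of_norm_le
  abs_torusMoment_le_of_momentBounds momentBounds_of_momentBounds6)
open Summit.QuantumFields.YangMills.Theorems.NPointIsotropy.Negative (E4)

namespace Summit.QuantumFields.YangMills.Theorems.ROT.Ward

/-! ## §1 The continuum generator versus the lattice generator: a second-order Taylor remainder -/

section Taylor

variable {n : ℕ}

/-- The derivative of a compactly supported test function is Lipschitz (its own derivative is bounded). -/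
theorem exists_lipschitz_fderiv (F : 𝓢((Fin n → E4), ℂ)) (hFc : HasCompactSupport (F : (Fin n → E4) → ℂ)) :
    ∃ K : ℝ, 0 ≤ K ∧ ∀ y₁ y₂ : Fin n → E4,
      ‖fderiv ℝ (F : (Fin n → E4) → ℂ) y₁ - fderiv ℝ (F : (Fin n → E4) → ℂ) y₂‖ ≤ K * ‖y₁ - y₂‖ := by
  set F' : 𝓢((Fin n → E4), (Fin n → E4) →L[ℝ] ℂ) := SchwartzMap.fderivCLM ℝ (Fin n → E4) ℂ F with hF'
  have hF'eq : (F' : (Fin n → E4) → ((Fin n → E4) →L[ℝ] ℂ)) = fderiv ℝ (F : (Fin n → E4) → ℂ) := by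
    funext y; exact SchwartzMap.fderivCLM_apply (𝕜 := ℝ) F y
  have hF'c : HasCompactSupport (F' : (Fin n → E4) → ((Fin n → E4) →L[ℝ] ℂ)) := by
    rw [hF'eq]; exact hFc.fderiv ℝ
  obtain ⟨K, hK⟩ := (F'.smooth 1).continuous_fderiv (by simp) |>.bounded_above_of_compact_support (hF'c.fderiv ℝ)
  have hK0 : 0 ≤ K := (norm_nonneg _).trans (hK 0)
  refine ⟨K, hK0, fun y₁ y₂ => ?_⟩
  rw [← hF'eq]
  exact Convex.norm_image_sub_le_of_norm_fderiv_le (f := (F' : (Fin n → E4) → ((Fin n → E4) →L[ℝ] ℂ)))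
    (fun y _ => F'.differentiableAt) (fun y _ => hK y) convex_univ (Set.mem_univ y₂) (Set.mem_univ y₁)

/-- **Second-order Taylor remainder**: `‖F(y+v) − F(y) − dF(y)·v‖ ≤ K ‖v‖²` when `dF` is `K`-Lipschitz. -/
theorem norm_taylor_two_le (F : 𝓢((Fin n → E4), ℂ)) {K : ℝ} (hK0 : 0 ≤ K)
    (hK : ∀ y₁ y₂ : Fin n → E4,
      ‖fderiv ℝ (F : (Fin n → E4) → ℂ) y₁ - fderiv ℝ (F : (Fin n → E4) → ℂ) y₂‖ ≤ K * ‖y₁ - y₂‖)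
    (y v : Fin n → E4) :
    ‖F (y + v) - F y - fderiv ℝ (F : (Fin n → E4) → ℂ) y v‖ ≤ K * ‖v‖ ^ 2 := by
  set H : ℝ → ℂ := fun t => F (y + t • v) - t • fderiv ℝ (F : (Fin n → E4) → ℂ) y v with hH
  have hderiv : ∀ t : ℝ, HasDerivAt H
      (fderiv ℝ (F : (Fin n → E4) → ℂ) (y + t • v) v - fderiv ℝ (F : (Fin n → E4) → ℂ) y v) t := by
    intro t
    have h1 : HasDerivAt (fun t : ℝ => y + t • v) v t := by
      simpa using ((hasDerivAt_id t).smul_const v).const_add y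
    have h2 := (F.hasFDerivAt (y + t • v)).comp_hasDerivAt t h1
    have h3 : HasDerivAt (fun t : ℝ => t • fderiv ℝ (F : (Fin n → E4) → ℂ) y v)
        (fderiv ℝ (F : (Fin n → E4) → ℂ) y v) t := by
      simpa using (hasDerivAt_id t).smul_const (fderiv ℝ (F : (Fin n → E4) → ℂ) y v)
    exact h2.sub h3
  have hbound : ∀ t ∈ Set.Icc (0 : ℝ) 1,
      ‖fderiv ℝ (F : (Fin n → E4) → ℂ) (y + t • v) v - fderiv ℝ (F : (Fin n → E4) → ℂ) y v‖ ≤ K * ‖v‖ ^ 2 := by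
    intro t ht
    refine (ContinuousLinearMap.le_opNorm
      (fderiv ℝ (F : (Fin n → E4) → ℂ) (y + t • v) - fderiv ℝ (F : (Fin n → E4) → ℂ) y) v).trans ?_
    have h1 := hK (y + t • v) y
    rw [add_sub_cancel_left, norm_smul, Real.norm_eq_abs, abs_of_nonneg ht.1] at h1
    calc ‖fderiv ℝ (F : (Fin n → E4) → ℂ) (y + t • v) - fderiv ℝ (F : (Fin n → E4) → ℂ) y‖ * ‖v‖
        ≤ (K * (t * ‖v‖)) * ‖v‖ := by gcongr
      _ ≤ (K * (1 * ‖v‖)) * ‖v‖ := by gcongr; exact ht.2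
      _ = K * ‖v‖ ^ 2 := by ring
  have key := Convex.norm_image_sub_le_of_norm_hasDerivWithin_le (fun t _ => (hderiv t).hasDerivWithinAt) hbound
    (convex_Icc 0 1) (Set.left_mem_Icc.2 zero_le_one) (Set.right_mem_Icc.2 zero_le_one)
  have hH1 : H 1 - H 0 = F (y + v) - F y - fderiv ℝ (F : (Fin n → E4) → ℂ) y v := by
    simp only [hH, one_smul, zero_smul, add_zero, sub_zero]
    ring
  rw [← hH1]
  simpa using key

/-- The generator field of the plane rotations is the combination `Σᵢ (yᵢ⁰ ê_{i,1} − yᵢ¹ ê_{i,0})` of the slot unit vectors. -/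
theorem rotField_eq_sum (y : Fin n → E4) :
    (fun k => (y k 0) • (EuclideanSpace.single 1 1 : E4) - (y k 1) • (EuclideanSpace.single 0 1 : E4)) =
      ∑ i, ((y i 0) • contUnitVec i 1 - (y i 1) • contUnitVec i 0) := by
  funext k
  rw [Finset.sum_apply, Finset.sum_eq_single k]
  · simp [contUnitVec]
  · intro i _ hik
    simp [contUnitVec, Ne.symm hik]
  · intro hk; exact absurd (Finset.mem_univ k) hk

/-- **Continuum generator minus lattice generator, pointwise**: at the lattice multi-site `x`,
`E_a F(x) − (D F)(a x) = Σᵢ (xᵢ⁰ ρ(a x, a ê_{i,1}) − xᵢ¹ ρ(a x, a ê_{i,0}))` with `ρ(y, v) = F(y+v) − F(y) − dF(y)·v`. -/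
theorem latGen_sub_rotDeriv (F D : 𝓢((Fin n → E4), ℂ))
    (hD : ∀ x, D x = fderiv ℝ (F : (Fin n → E4) → ℂ) x
      (fun k => (x k 0) • (EuclideanSpace.single 1 1 : E4) - (x k 1) • (EuclideanSpace.single 0 1 : E4)))
    (a : ℝ) (x : Fin n → Site 4) :
    latGen a F x - D (scaleSite a x) =
      ∑ i, ((((x i 0 : ℤ) : ℝ) : ℂ) * (F (scaleSite a x + a • contUnitVec i 1) - F (scaleSite a x) -
          fderiv ℝ (F : (Fin n → E4) → ℂ) (scaleSite a x) (a • contUnitVec i 1)) -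
        (((x i 1 : ℤ) : ℝ) : ℂ) * (F (scaleSite a x + a • contUnitVec i 0) - F (scaleSite a x) -
          fderiv ℝ (F : (Fin n → E4) → ℂ) (scaleSite a x) (a • contUnitVec i 0))) := by
  rw [hD, rotField_eq_sum, map_sum, latGen, ← Finset.sum_sub_distrib]
  refine Finset.sum_congr rfl fun i _ => ?_
  simp only [scaleSite_add_unitVec, map_sub, map_smul, scaleSite_apply, Complex.real_smul]
  push_cast
  ring

/-- **The comparison is `O(a²‖x‖)`**: `‖E_a F(x) − (D F)(a x)‖ ≤ 2 n K a² ‖x‖∞` when `dF` is `K`-Lipschitz. -/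
theorem norm_latGen_sub_rotDeriv_le (F D : 𝓢((Fin n → E4), ℂ))
    (hD : ∀ x, D x = fderiv ℝ (F : (Fin n → E4) → ℂ) x
      (fun k => (x k 0) • (EuclideanSpace.single 1 1 : E4) - (x k 1) • (EuclideanSpace.single 0 1 : E4)))
    {K : ℝ} (hK0 : 0 ≤ K)
    (hK : ∀ y₁ y₂ : Fin n → E4,
      ‖fderiv ℝ (F : (Fin n → E4) → ℂ) y₁ - fderiv ℝ (F : (Fin n → E4) → ℂ) y₂‖ ≤ K * ‖y₁ - y₂‖)
    (a : ℝ) (x : Fin n → Site 4) :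
    ‖latGen a F x - D (scaleSite a x)‖ ≤ 2 * n * K * a ^ 2 * ‖x‖ := by
  rw [latGen_sub_rotDeriv F D hD a x]
  have hcoord : ∀ (i : Fin n) (ν : Fin 4), ‖(((x i ν : ℤ) : ℝ) : ℂ)‖ ≤ ‖x‖ := by
    intro i ν
    rw [Complex.norm_real, Int.norm_cast_real]
    exact (norm_le_pi_norm (x i) ν).trans (norm_le_pi_norm x i)
  have hrem : ∀ (i : Fin n) (μ : Fin 4), ‖F (scaleSite a x + a • contUnitVec i μ) - F (scaleSite a x) -
      fderiv ℝ (F : (Fin n → E4) → ℂ) (scaleSite a x) (a • contUnitVec i μ)‖ ≤ K * a ^ 2 := by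
    intro i μ
    refine (norm_taylor_two_le F hK0 hK _ _).trans ?_
    rw [norm_smul, norm_contUnitVec, mul_one, Real.norm_eq_abs, sq_abs]
  calc _ ≤ ∑ i : Fin n, (‖x‖ * (K * a ^ 2) + ‖x‖ * (K * a ^ 2)) := by
        refine (norm_sum_le _ _).trans (Finset.sum_le_sum fun i _ => (norm_sub_le _ _).trans ?_)
        rw [norm_mul, norm_mul]
        exact add_le_add (mul_le_mul (hcoord i 0) (hrem i 1) (norm_nonneg _) (norm_nonneg _))
          (mul_le_mul (hcoord i 1) (hrem i 0) (norm_nonneg _) (norm_nonneg _))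
    _ = 2 * n * K * a ^ 2 * ‖x‖ := by
        rw [Finset.sum_const, Finset.card_univ, Fintype.card_fin, nsmul_eq_mul]
        ring

/-- **Where the comparison term lives**: if `E_a F(x) − (D F)(a x) ≠ 0` then some point of `tsupport F` is `a x` or
`a x + a ê_{i,μ}`. -/
theorem exists_mem_tsupport_of_latGen_sub_rotDeriv_ne_zero (F D : 𝓢((Fin n → E4), ℂ))
    (hD : ∀ x, D x = fderiv ℝ (F : (Fin n → E4) → ℂ) x
      (fun k => (x k 0) • (EuclideanSpace.single 1 1 : E4) - (x k 1) • (EuclideanSpace.single 0 1 : E4)))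
    (a : ℝ) (x : Fin n → Site 4) (hne : latGen a F x - D (scaleSite a x) ≠ 0) :
    scaleSite a x ∈ tsupport (F : (Fin n → E4) → ℂ) ∨
      ∃ (i : Fin n) (μ : Fin 4), scaleSite a x + a • contUnitVec i μ ∈ tsupport (F : (Fin n → E4) → ℂ) := by
  by_contra h
  push Not at h
  obtain ⟨h0, h1⟩ := h
  apply hne
  rw [latGen_sub_rotDeriv F D hD a x]
  refine Finset.sum_eq_zero fun i _ => ?_
  rw [image_eq_zero_of_notMem_tsupport h0, image_eq_zero_of_notMem_tsupport (h1 i 1),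
    image_eq_zero_of_notMem_tsupport (h1 i 0), fderiv_of_notMem_tsupport ℝ h0]
  simp

end Taylor

/-! ## §2–§3 Counting scaled box sites in a ball; the collar bound at scaled-separated multi-sites -/

section Counting

variable {n : ℕ}

/-- **Riemann-sum count**: along lattices with `a_k → 0⁺` and `a_k L_k → ∞`, the number of multi-sites `x ∈ (box L_k)ⁿ` with
`‖a_k x‖ ≤ ρ + 1`, times `a_k^{4n}`, is eventually bounded (by `1 + ∫ g` for a continuous bump `g ≥ 1_{B(0,ρ+1)}`). -/
theorem eventually_card_scaled_le (ρ : ℝ) (as : ℕ → ℝ) (Ls : ℕ → ℕ) (ha : ∀ k, 0 < as k)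
    (ha0 : Tendsto as atTop (𝓝 0)) (haL : Tendsto (fun k => as k * (Ls k : ℝ)) atTop atTop) :
    ∃ M : ℝ, 0 ≤ M ∧ ∀ᶠ k in atTop, as k ^ (4 * n) *
      (((Fintype.piFinset (fun _ : Fin n => box 4 (Ls k))).filter
        (fun x => ‖scaleSite (as k) x‖ ≤ ρ + 1)).card : ℝ) ≤ M := by
  classical
  -- a continuous compactly supported bump `g` with `1_{B(0,ρ+1)} ≤ g ≤ 1`
  set g : (Fin n → E4) → ℝ := fun y => max 0 (min 1 (ρ + 2 - ‖y‖)) with hg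
  have hgc : Continuous g := by
    refine continuous_const.max (continuous_const.min (continuous_const.sub continuous_norm))
  have hg0 : ∀ y, 0 ≤ g y := fun y => le_max_left _ _
  have hg1 : ∀ y, ‖y‖ ≤ ρ + 1 → g y = 1 := by
    intro y hy
    rw [hg]
    simp only
    rw [min_eq_left (by linarith), max_eq_right zero_le_one]
  have hgsupp : HasCompactSupport g := by
    refine HasCompactSupport.intro (isCompact_closedBall (0 : Fin n → E4) (ρ + 2)) fun y hy => ?_
    rw [mem_closedBall, dist_zero_right, not_le] at hy
    rw [hg]
    simp only
    rw [min_eq_right (by linarith), max_eq_left (by linarith)]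
  have hRiem := Summit.QuantumFields.YangMills.Cruxes.OSLegsAtWeakCouplingC.Sketch.tendsto_riemann_sum g hgc hgsupp
    as Ls ha ha0 haL
  refine ⟨(∫ y, g y) + 1, by positivity, ?_⟩
  filter_upwards [hRiem.eventually (eventually_le_nhds (show (∫ y, g y) < (∫ y, g y) + 1 by linarith))] with k hk
  refine le_trans ?_ hk
  refine mul_le_mul_of_nonneg_left ?_ (pow_nonneg (ha k).le _)
  -- `card (filter) = Σ_filter 1 ≤ Σ_filter g = Σ g · 1_filter ≤ Σ g`
  rw [← Finset.sum_filter_add_sum_filter_not _ (fun x => ‖scaleSite (as k) x‖ ≤ ρ + 1)]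
  have h1 : (((Fintype.piFinset (fun _ : Fin n => box 4 (Ls k))).filter
      (fun x => ‖scaleSite (as k) x‖ ≤ ρ + 1)).card : ℝ) =
      ∑ x ∈ (Fintype.piFinset (fun _ : Fin n => box 4 (Ls k))).filter (fun x => ‖scaleSite (as k) x‖ ≤ ρ + 1),
        g (fun i => as k • siteToE (x i)) := by
    rw [Finset.card_eq_sum_ones, Nat.cast_sum, Nat.cast_one]
    refine Finset.sum_congr rfl fun x hx => ?_
    rw [Finset.mem_filter] at hx
    exact (hg1 _ hx.2).symm
  rw [h1]
  exact le_add_of_nonneg_right (Finset.sum_nonneg fun x _ => hg0 _)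

end Counting

section Collar

variable {G : Type} [Group G] [TopologicalSpace G] [IsTopologicalGroup G] [CompactSpace G]
  [MeasurableSpace G] [BorelSpace G]

/-- **The collar bound at scaled-separated multi-sites** (the estimate inside the landed
`offDiagDensity_of_tendsto_latticeDist`, isolated): in the regime `0 < a ≤ min 1 ℓ₄`, `12 a ≤ δ`, `L ≥ 14`, `L ≥ a⁻²`, at a
multi-site in the bulk (`2‖xᵢ‖ ≤ L`) whose scaled points are pairwise `≥ δ` apart, the (unpacked) `MomentBounds` estimate `H`
gives `|W(x)| ≤ (C κ⁴)ⁿ a⁴ⁿ`, `κ = 24/δ + 2/ℓ₄ + 24`. -/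
theorem abs_torusMoment_le_of_scaled_separated (r : LatticeRep G) {C ℓ₄ β a δ : ℝ} {L n : ℕ} (hℓ : 0 < ℓ₄)
    (hC : 0 ≤ C)
    (H : ∀ (x : Fin n → Site 4) (R : ℕ), 1 ≤ R → (R : ℝ) * a ≤ ℓ₄ → 4 * R + 8 ≤ L →
      (∀ i j : Fin n, i ≠ j → ∃ k : Fin 4,
        (2 * (R : ℤ) + 4) ≤ |((((x i k - x j k : ℤ) : ZMod (2 * L + 1))).valMinAbs : ℤ)|) →
      |torusMoment r.ρ β L r.curvature.F (wilsonTorusMean r.ρ β L r.curvature.F) x| ≤ (C / (R : ℝ) ^ 4) ^ n)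
    (ha : 0 < a) (ha1 : a ≤ 1) (haℓ : a ≤ ℓ₄) (haδ : a * 12 ≤ δ) (hL14 : 14 ≤ L) (hLa : a⁻¹ * a⁻¹ ≤ L)
    (x : Fin n → Site 4) (hwrap : ∀ i, 2 * ‖x i‖ ≤ (L : ℝ))
    (hsep : ∀ i j : Fin n, i ≠ j → δ ≤ dist (scaleSite a x i) (scaleSite a x j)) :
    |torusMoment r.ρ β L r.curvature.F (wilsonTorusMean r.ρ β L r.curvature.F) x| ≤
      (C * (24 / δ + 2 / ℓ₄ + 24) ^ 4) ^ n * a ^ (4 * n) := by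
  -- adapted from `Theorems.ROT.offDiagDensity_of_tendsto_latticeDist` (BalabanLadderROTUVExtract.lean)
  set κ : ℝ := 24 / δ + 2 / ℓ₄ + 24 with hκ
  have hδ : 0 < δ := lt_of_lt_of_le (by positivity) haδ
  have hδ6 : 6 ≤ δ / (2 * a) := by
    rw [le_div_iff₀ (by positivity)]
    linarith
  obtain ⟨R, hR1, hRa, hRL, hRδ, hRinv⟩ := exists_collar_radius hδ6 hℓ ha ha1 haℓ hL14 hLa
  have hRpos : (0 : ℝ) < R := by exact_mod_cast hR1
  have hRinv' : (R : ℝ)⁻¹ ≤ a * κ := by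
    have : 12 / (δ / (2 * a)) + a * (2 / ℓ₄ + 24) = a * κ := by
      rw [hκ, div_div_eq_mul_div]
      ring
    rw [← this]
    exact hRinv
  have hsepx : ∀ i j : Fin n, i ≠ j → 2 * (R : ℝ) + 4 ≤ ‖x i - x j‖ := by
    intro i j hij
    have h1 : δ ≤ dist (a • siteToE (x i)) (a • siteToE (x j)) := hsep i j hij
    rw [dist_eq_norm] at h1
    have h2 := norm_smul_siteToE_sub_le ha.le (x i) (x j)
    have h3 : δ / (2 * a) ≤ ‖x i - x j‖ := by
      rw [div_le_iff₀ (by positivity)]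
      linarith
    exact hRδ.trans h3
  have hsep' : ∀ i j : Fin n, i ≠ j → ∃ l : Fin 4,
      (2 * (R : ℤ) + 4) ≤ |((((x i l - x j l : ℤ) : ZMod (2 * L + 1))).valMinAbs : ℤ)| := by
    intro i j hij
    obtain ⟨l, hl⟩ := exists_valMinAbs_ge_of_norm_le x hwrap i j (hsepx i j hij)
    exact ⟨l, by exact_mod_cast hl⟩
  have h1 := H x R hR1 hRa hRL hsep'
  have h2 : C / (R : ℝ) ^ 4 ≤ C * κ ^ 4 * a ^ 4 := by
    have h3 : ((R : ℝ)⁻¹) ^ 4 ≤ (a * κ) ^ 4 := pow_le_pow_left₀ (inv_nonneg.2 hRpos.le) hRinv' 4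
    calc C / (R : ℝ) ^ 4 = C * ((R : ℝ)⁻¹) ^ 4 := by rw [div_eq_mul_inv, inv_pow]
      _ ≤ C * (a * κ) ^ 4 := mul_le_mul_of_nonneg_left h3 hC
      _ = C * κ ^ 4 * a ^ 4 := by ring
  calc _ ≤ (C / (R : ℝ) ^ 4) ^ n := h1
    _ ≤ (C * κ ^ 4 * a ^ 4) ^ n := pow_le_pow_left₀ (div_nonneg hC (pow_nonneg hRpos.le 4)) h2 n
    _ = (C * κ ^ 4) ^ n * a ^ (4 * n) := by rw [mul_pow, pow_mul]

end Collar

end Summit.QuantumFields.YangMills.Theorems.ROT.Ward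

end
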